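import Literature.Topology.FourManifolds.PushedDiscFromSphereRegion
import HarnessLib

/-!
# Pushing a disc off a hypersurface into a collar: `x ↦ (E (dir x), μ ‖x‖) ∈ M × ℝ`

Topic `Literature/Topology/FourManifolds`; brick D3-a′ of the constructive road (P1′) to
`Literature.Topology.FourManifolds.Trisection.isConnectedSum_of_reducing_separating`
(`ReducibleTrisectionSplitting.lean`, § Status), the **collar form** of
`PushedDiscFromSphereRegion.lean`.  There the region `E(𝔻ⁿ)` lay on the round unit sphere and
the disc was pushed radially into the round ball; here `E : V → M` is a smooth embedding of a
Euclidean space into an ARBITRARY manifold `M` (in the application: a ball region of a level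
`3`-sphere `Σ` of a `4`-manifold, delivered by Alexander's theorem) and the disc is pushed into
the abstract collar `M × ℝ` (to be composed with a bicollar `Σ × (-δ, δ) ↪ Z` of the
hypersurface):

  `pushC P E x = (E (P.dir x), P.μ ‖x‖) ∈ M × ℝ`,

with the profiles `μ`, `ν` (`dir x = (ν ‖x‖/‖x‖) x`) of a `Literature.Topology.FourManifolds.PushProfile`.
Exactly as in the round case: on the rim `1 - ε ≤ ‖x‖` the map is `(E (x/‖x‖), ‖x‖)`
(**straight along the collar lines**, `pushC_of_le_norm`), on the unit sphere it is `(E x, 1)`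
(`pushC_of_norm_eq_one`), on the floor `‖x‖ ≤ 1 - 3ε` it is `(E x, 1 - 2ε)`
(`pushC_of_norm_le`); the height `(pushC x).2 = μ ‖x‖` lies in `[1 - 2ε, 1]` on the closed
ball and equals `1` exactly on the unit sphere (NEATNESS, `snd_pushC_eq_one_iff`); `pushC` is
smooth (`contMDiff_pushC`), injective (`injective_pushC`), an immersion
(`injective_mfderiv_pushC`: the height controls the radial direction where `μ' > 0`, the
direction profile the rest, `PushProfile.eq_zero_of_dirDeriv_eq_zero(_of_inner)`), proper, hence
a smooth closed embedding `V ↪ M × ℝ` (`isSmoothEmbedding_pushC`); and the laminar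
disjointness lemmas hold verbatim (`disjoint_image_pushC_of_disjoint`,
`disjoint_image_pushC_of_subset`).  Everything is **proved**; one definition (`pushC`), no
named fact.

## References
* A. A. Kosinski, *Differential Manifolds* (1993), VI §5–§6 (collars; pushing into a collar).
  [Kosinski1993]
* M. W. Hirsch, *Differential Topology*, GTM 33 (1976), Ch. 4 §6 (collars). [HirschDT1976]
-/

noncomputable section

open scoped Manifold ContDiff Topology RealInnerProductSpace
open Set Function Metric Filter

namespace Literature.Topology.FourManifolds

namespace PushProfile

section CollarSet

variable (P : PushProfile) {V : Type*} [NormedAddCommGroup V] [InnerProductSpace ℝ V] {M : Type*}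

/-- **The collar push** of the region `E : V → M`: `pushC E x = (E (dir x), μ ‖x‖)`.
[cite: Kosinski1993, VI §5] -/
def pushC (E : V → M) (x : V) : M × ℝ := (E (P.dir x), P.μ ‖x‖)

variable (E : V → M)

/-- First component of `pushC`. [folklore] -/
@[simp] theorem pushC_fst (x : V) : (P.pushC E x).1 = E (P.dir x) := rfl

/-- Second component (the height) of `pushC`. [folklore] -/
@[simp] theorem pushC_snd (x : V) : (P.pushC E x).2 = P.μ ‖x‖ := rfl

/-- **Straight rim**: for `1 - ε ≤ ‖x‖`, `pushC x = (E (x/‖x‖), ‖x‖)` runs along the collar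
line over `E (x/‖x‖)`. [folklore] -/
theorem pushC_of_le_norm {x : V} (hx : 1 - P.ε ≤ ‖x‖) : P.pushC E x = (E (‖x‖⁻¹ • x), ‖x‖) := by
  rw [pushC, P.dir_of_le_norm hx, P.μ_of_ge _ hx]

/-- On the unit sphere `pushC x = (E x, 1)`. [folklore] -/
theorem pushC_of_norm_eq_one {x : V} (hx : ‖x‖ = 1) : P.pushC E x = (E x, 1) := by
  rw [pushC, P.dir_of_norm_eq_one hx, hx, P.μ_one]

/-- **Flat floor**: for `‖x‖ ≤ 1 - 3ε`, `pushC x = (E x, 1 - 2ε)`. [folklore] -/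
theorem pushC_of_norm_le {x : V} (hx : ‖x‖ ≤ 1 - 3 * P.ε) : P.pushC E x = (E x, 1 - 2 * P.ε) := by
  rw [pushC, P.dir_of_norm_le hx, P.μ_of_le _ (by linarith [P.ε_pos])]

/-- The height is at least `1 - 2ε`. [folklore] -/
theorem le_snd_pushC (x : V) : 1 - 2 * P.ε ≤ (P.pushC E x).2 := P.le_μ _

/-- The height is `< 1` inside the unit ball. [folklore] -/
theorem snd_pushC_lt_one {x : V} (hx : ‖x‖ < 1) : (P.pushC E x).2 < 1 := P.μ_lt_one hx

/-- The height is `≤ 1` on the closed unit ball. [folklore] -/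
theorem snd_pushC_le_one {x : V} (hx : ‖x‖ ≤ 1) : (P.pushC E x).2 ≤ 1 := P.μ_le_one hx

/-- **Neatness**: the height is `1` exactly on the unit sphere. [folklore] -/
theorem snd_pushC_eq_one_iff (x : V) : (P.pushC E x).2 = 1 ↔ ‖x‖ = 1 := P.μ_eq_one_iff _

/-- The first component stays in the region `E(𝔻)` over the closed unit ball. [folklore] -/
theorem fst_pushC_mem (x : V) : (P.pushC E x).1 ∈ E '' closedBall 0 1 :=
  ⟨P.dir x, mem_closedBall_zero_iff.2 (P.norm_dir_le_one x), rfl⟩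

/-- The pushed closed disc lies in `E(𝔻) × [1 - 2ε, 1]`. [folklore] -/
theorem pushC_mem_prod {x : V} (hx : ‖x‖ ≤ 1) :
    P.pushC E x ∈ (E '' closedBall 0 1) ×ˢ Icc (1 - 2 * P.ε) 1 :=
  ⟨P.fst_pushC_mem E x, P.le_snd_pushC E x, P.snd_pushC_le_one E hx⟩

/-- The rim: `pushC (∂𝔻) = E(∂𝔻) × {1}`. [folklore] -/
theorem image_pushC_sphere : P.pushC E '' sphere 0 1 = (E '' sphere 0 1) ×ˢ {(1 : ℝ)} := by
  ext z
  simp only [mem_image, mem_sphere_zero_iff_norm, mem_prod, mem_singleton_iff]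
  constructor
  · rintro ⟨x, hx, rfl⟩
    exact ⟨⟨x, hx, by rw [P.pushC_of_norm_eq_one E hx]⟩, by rw [P.pushC_of_norm_eq_one E hx]⟩
  · rintro ⟨⟨x, hx, h1⟩, h2⟩
    refine ⟨x, hx, ?_⟩
    rw [P.pushC_of_norm_eq_one E hx]
    exact Prod.ext h1 h2.symm

/-- Only the rim has height `1`. [folklore] -/
theorem preimage_pushC_snd_one : P.pushC E ⁻¹' (Prod.snd ⁻¹' {1}) = sphere 0 1 := by
  ext x
  simp only [mem_preimage, mem_singleton_iff, mem_sphere_zero_iff_norm, P.snd_pushC_eq_one_iff E]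

/-! #### Smoothness -/

/-- `x ↦ μ ‖x‖` is smooth (constant near the origin). [folklore] -/
theorem contDiff_μ_norm : ContDiff ℝ ∞ fun x : V => P.μ ‖x‖ := by
  rw [contDiff_iff_contDiffAt]
  intro x
  rcases eq_or_ne x 0 with h | h
  · have hev : (fun x : V => P.μ ‖x‖) =ᶠ[𝓝 x] fun _ => 1 - 2 * P.ε := by
      have hm : ball (0 : V) (1 - 2 * P.ε) ∈ 𝓝 x := by
        rw [h]; exact ball_mem_nhds _ (by linarith [P.ε_pos, P.ε_le])
      exact eventuallyEq_of_mem hm fun y hy => P.μ_of_le _ (le_of_lt (by simpa using hy))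
    exact contDiffAt_const.congr_of_eventuallyEq hev
  · exact P.contDiff_μ.contDiffAt.comp x (contDiffAt_norm ℝ h)

/-! #### Injectivity -/

/-- **`pushC` is injective** (for `E` injective): heights give `μ ‖x‖ = μ ‖y‖`, first
components give `dir x = dir y` hence `ν ‖x‖ = ν ‖y‖`, so `‖x‖ = ‖y‖`
(`eq_of_μ_eq_of_ν_eq`) and then `x = y`. [folklore] -/
theorem injective_pushC (hEi : Injective E) : Injective (P.pushC E) := by
  intro x y hxy
  have hn : P.μ ‖x‖ = P.μ ‖y‖ := congrArg Prod.snd hxy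
  have hd : P.dir x = P.dir y := hEi (congrArg Prod.fst hxy)
  have hν : P.ν ‖x‖ = P.ν ‖y‖ := by rw [← P.norm_dir, ← P.norm_dir, hd]
  have hr : ‖x‖ = ‖y‖ := P.eq_of_μ_eq_of_ν_eq (norm_nonneg _) (norm_nonneg _) hn hν
  unfold dir at hd
  rw [hr] at hd
  exact smul_right_injective V (P.dirScale_pos (norm_nonneg y)).ne' hd

end CollarSet

section Collar

variable (P : PushProfile) {V : Type*} [NormedAddCommGroup V] [InnerProductSpace ℝ V]
  {EM : Type*} [NormedAddCommGroup EM] [NormedSpace ℝ EM] {HM : Type*} [TopologicalSpace HM]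
  {I : ModelWithCorners ℝ EM HM} {M : Type*} [TopologicalSpace M] [ChartedSpace HM M]
  (E : V → M)

/-- `pushC` is continuous (for continuous `E`). [folklore] -/
theorem continuous_pushC (hE : Continuous E) : Continuous (P.pushC E) :=
  (hE.comp P.continuous_dir).prodMk (P.contDiff_μ_norm.continuous)

/-- `pushC` is smooth (for smooth `E`). [folklore] -/
theorem contMDiff_pushC (hE : ContMDiff 𝓘(ℝ, V) I ∞ E) :
    ContMDiff 𝓘(ℝ, V) (I.prod 𝓘(ℝ, ℝ)) ∞ (P.pushC E) :=
  (hE.comp P.contDiff_dir.contMDiff).prodMk P.contDiff_μ_norm.contMDiff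

/-! #### The differential is injective -/

/-- The differential of `pushC`: `(DE(dir x) ∘ D dir(x), D(μ ∘ ‖·‖)(x))`. [folklore] -/
theorem hasMFDerivAt_pushC (hE : ContMDiff 𝓘(ℝ, V) I ∞ E) (x : V) :
    HasMFDerivAt 𝓘(ℝ, V) (I.prod 𝓘(ℝ, ℝ)) (P.pushC E) x
      (((mfderiv 𝓘(ℝ, V) I E (P.dir x)).comp (mfderiv 𝓘(ℝ, V) 𝓘(ℝ, V) P.dir x)).prod
        (mfderiv 𝓘(ℝ, V) 𝓘(ℝ, ℝ) (fun y : V => P.μ ‖y‖) x)) := by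
  have hEd : MDifferentiableAt 𝓘(ℝ, V) I E (P.dir x) := hE.mdifferentiableAt (by simp)
  have hdir : MDifferentiableAt 𝓘(ℝ, V) 𝓘(ℝ, V) P.dir x :=
    P.contDiff_dir.contMDiff.mdifferentiableAt (by simp)
  have hμd : MDifferentiableAt 𝓘(ℝ, V) 𝓘(ℝ, ℝ) (fun y : V => P.μ ‖y‖) x :=
    P.contDiff_μ_norm.contMDiff.mdifferentiableAt (by simp)
  exact (HasMFDerivAt.comp x hEd.hasMFDerivAt hdir.hasMFDerivAt).prodMk hμd.hasMFDerivAt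

set_option backward.isDefEq.respectTransparency false in
/-- **`pushC` is an immersion**: its differential is injective everywhere (for smooth `E` with
injective differential).  A kernel vector `v` has `DE(dir x)(D dir(x) v) = 0`, so
`D dir(x) v = 0`, and `D(μ ∘ ‖·‖)(x) v = 0`.  On the floor `‖x‖ < 1 - 3ε`, `D dir = id`;
for `x ≠ 0` with `‖x‖ < 1 - ε` the first forces `v = 0` (`ν' > 0`,
`eq_zero_of_dirDeriv_eq_zero`); for `‖x‖ ≥ 1 - ε` the second reads `μ'(‖x‖)⟨x, v⟩/‖x‖ = 0`
with `μ' > 0`, so `⟨x, v⟩ = 0`, and then the first does (`eq_zero_of_dirDeriv_eq_zero_of_inner`).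
[folklore] -/
theorem injective_mfderiv_pushC (hE : ContMDiff 𝓘(ℝ, V) I ∞ E)
    (hEd : ∀ y, Injective (mfderiv 𝓘(ℝ, V) I E y)) (x : V) :
    Injective (mfderiv 𝓘(ℝ, V) (I.prod 𝓘(ℝ, ℝ)) (P.pushC E) x) := by
  rw [(P.hasMFDerivAt_pushC E hE x).mfderiv]
  refine (injective_iff_map_eq_zero _).2 fun v hv => ?_
  have h1 : mfderiv 𝓘(ℝ, V) I E (P.dir x) (mfderiv 𝓘(ℝ, V) 𝓘(ℝ, V) P.dir x v) = 0 :=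
    congrArg Prod.fst hv
  have h2 : mfderiv 𝓘(ℝ, V) 𝓘(ℝ, ℝ) (fun y : V => P.μ ‖y‖) x v = 0 := congrArg Prod.snd hv
  have hw' : mfderiv 𝓘(ℝ, V) 𝓘(ℝ, V) P.dir x v = 0 :=
    (injective_iff_map_eq_zero _).1 (hEd (P.dir x)) _ h1
  rcases lt_or_ge ‖x‖ (1 - 3 * P.ε) with hx3 | hx3
  · have e : mfderiv 𝓘(ℝ, V) 𝓘(ℝ, V) P.dir x = ContinuousLinearMap.id ℝ V :=
      (P.hasFDerivAt_dir_of_norm_lt hx3).hasMFDerivAt.mfderiv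
    rw [e] at hw'
    exact hw'
  · have hx : x ≠ 0 := by
      intro h
      rw [h, norm_zero] at hx3
      linarith [P.one_sub_three_mul_pos]
    have hr : 0 < ‖x‖ := norm_pos_iff.2 hx
    have e : mfderiv 𝓘(ℝ, V) 𝓘(ℝ, V) P.dir x = P.dirDeriv x :=
      (P.hasFDerivAt_dir hx).hasMFDerivAt.mfderiv
    rw [e] at hw'
    have hw : P.dirDeriv x v = 0 := hw'
    rcases lt_or_ge ‖x‖ (1 - P.ε) with hx1 | hx1
    · have h := P.eq_zero_of_dirDeriv_eq_zero hx hx1 hw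
      exact h
    · have hμ : HasDerivAt P.μ (deriv P.μ ‖x‖) ‖x‖ :=
        ((P.contDiff_μ.differentiable (by simp)).differentiableAt).hasDerivAt
      have e2 : mfderiv 𝓘(ℝ, V) 𝓘(ℝ, ℝ) (fun y : V => P.μ ‖y‖) x =
          (deriv P.μ ‖x‖) • (‖x‖⁻¹ • innerSL ℝ x) :=
        (hasFDerivAt_comp_norm hx hμ).hasMFDerivAt.mfderiv
      rw [e2] at h2
      have h2' : deriv P.μ ‖x‖ * (‖x‖⁻¹ * ⟪x, v⟫) = 0 := by
        have h3 : ((deriv P.μ ‖x‖) • (‖x‖⁻¹ • innerSL ℝ x)) v =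
            deriv P.μ ‖x‖ * (‖x‖⁻¹ * ⟪x, v⟫) := by
          simp
        rw [← h3]
        exact h2
      have hμ' : 0 < deriv P.μ ‖x‖ := P.μ_deriv_pos _ (by linarith [P.ε_pos])
      have hxv : ⟪x, v⟫ = 0 := by
        rcases mul_eq_zero.1 h2' with h | h
        · exact absurd h hμ'.ne'
        · rcases mul_eq_zero.1 h with h | h
          · exact absurd h (inv_ne_zero hr.ne')
          · exact h
      have h := P.eq_zero_of_dirDeriv_eq_zero_of_inner hxv hw
      exact h

/-! #### The pushed disc is a smooth closed embedding -/

/-- Preimages of compact sets under `pushC` are compact (the height is `‖x‖` for `‖x‖ ≥ 1`),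
so `pushC` is proper. [folklore] -/
theorem isCompact_preimage_pushC [FiniteDimensional ℝ V] [T2Space M] (hE : Continuous E)
    {K : Set (M × ℝ)} (hK : IsCompact K) : IsCompact (P.pushC E ⁻¹' K) := by
  obtain ⟨R, hR⟩ := (hK.image continuous_snd).isBounded.subset_closedBall 0
  apply Metric.isCompact_of_isClosed_isBounded (hK.isClosed.preimage (P.continuous_pushC E hE))
  refine (isBounded_iff_subset_closedBall 0).2 ⟨max R 1, fun x hx => ?_⟩
  rw [mem_closedBall_zero_iff]
  rcases le_or_gt ‖x‖ 1 with h | h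
  · exact h.trans (le_max_right _ _)
  · have hn : (P.pushC E x).2 = ‖x‖ := P.μ_of_ge _ (by linarith [P.ε_pos])
    have hxK : (P.pushC E x).2 ∈ closedBall (0 : ℝ) R := hR (mem_image_of_mem _ hx)
    rw [mem_closedBall_zero_iff, hn, Real.norm_eq_abs, abs_of_pos (by linarith)] at hxK
    exact hxK.trans (le_max_left _ _)

/-- `pushC` is a closed topological embedding (into a Hausdorff, locally compact `M × ℝ`).
[folklore] -/
theorem isClosedEmbedding_pushC [FiniteDimensional ℝ V] [T2Space M] [LocallyCompactSpace M]
    (hE : Continuous E) (hEi : Injective E) : Topology.IsClosedEmbedding (P.pushC E) :=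
  .of_continuous_injective_isClosedMap (P.continuous_pushC E hE) (P.injective_pushC E hEi)
    ((isProperMap_iff_isCompact_preimage.2
      ⟨P.continuous_pushC E hE, fun _ hK => P.isCompact_preimage_pushC E hE hK⟩).isClosedMap)

/-- **The collar-pushed disc is a smooth embedding** `V ↪ M × ℝ` (closed, proper): a smooth
injective immersion which is proper.  For `E : V → M` a smooth injective immersion into a
manifold without boundary modelled on a finite-dimensional space. [cite: Kosinski1993, VI §5] -/
theorem isSmoothEmbedding_pushC [FiniteDimensional ℝ V] [FiniteDimensional ℝ EM] [I.Boundaryless]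
    [T2Space M] [LocallyCompactSpace M] [IsManifold I ∞ M]
    (hE : ContMDiff 𝓘(ℝ, V) I ∞ E) (hEi : Injective E)
    (hEd : ∀ y, Injective (mfderiv 𝓘(ℝ, V) I E y)) :
    Manifold.IsSmoothEmbedding 𝓘(ℝ, V) (I.prod 𝓘(ℝ, ℝ)) ∞ (P.pushC E) :=
  ⟨isImmersion_of_injective_mfderiv (P.contMDiff_pushC E hE) (by exact_mod_cast le_top)
    (P.injective_mfderiv_pushC E hE hEd),
    (P.isClosedEmbedding_pushC E hE.continuous hEi).isEmbedding⟩

/-- The same for a smooth embedding `E`. [cite: Kosinski1993, VI §5] -/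
theorem isSmoothEmbedding_pushC_of_isSmoothEmbedding [FiniteDimensional ℝ V]
    [FiniteDimensional ℝ EM] [I.Boundaryless] [T2Space M] [LocallyCompactSpace M]
    [IsManifold I ∞ M] (hE : Manifold.IsSmoothEmbedding 𝓘(ℝ, V) I ∞ E) :
    Manifold.IsSmoothEmbedding 𝓘(ℝ, V) (I.prod 𝓘(ℝ, ℝ)) ∞ (P.pushC E) :=
  P.isSmoothEmbedding_pushC E hE.contMDiff hE.isEmbedding.injective
    fun y => injective_mfderiv_of_isImmersionAt' (hE.isImmersion.isImmersionAt y)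

end Collar

/-! #### Laminar families: disjointness of collar-pushed discs -/

section LaminarCollar

variable {V : Type*} [NormedAddCommGroup V] [InnerProductSpace ℝ V] {M : Type*}

/-- **Discs under disjoint regions are disjoint.** [folklore] -/
theorem disjoint_image_pushC_of_disjoint (P₁ P₂ : PushProfile) {E₁ E₂ : V → M}
    (h : Disjoint (E₁ '' closedBall 0 1) (E₂ '' closedBall 0 1)) :
    Disjoint (P₁.pushC E₁ '' closedBall 0 1) (P₂.pushC E₂ '' closedBall 0 1) := by
  rw [Set.disjoint_left]
  rintro z ⟨x₁, -, rfl⟩ ⟨x₂, -, h12⟩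
  have hdir : E₂ (P₂.dir x₂) = E₁ (P₁.dir x₁) := congrArg Prod.fst h12
  exact Set.disjoint_left.1 h ⟨P₁.dir x₁, mem_closedBall_zero_iff.2 (P₁.norm_dir_le_one x₁), rfl⟩
    ⟨P₂.dir x₂, mem_closedBall_zero_iff.2 (P₂.norm_dir_le_one x₂), hdir⟩

/-- **Nested regions: the inner disc hangs strictly above the outer one.**  If the region of
`E₂` lies in the floor part `E₁(𝔻_{1-3ε₁})` of the region of `E₁` (injective) and the inner
profile is finer (`ε₂ < ε₁`), the two pushed discs are disjoint: over the inner region the outer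
disc is at height exactly `1 - 2ε₁`, the inner one at height `≥ 1 - 2ε₂`. [folklore] -/
theorem disjoint_image_pushC_of_subset (P₁ P₂ : PushProfile) {E₁ E₂ : V → M}
    (hE₁ : Injective E₁) (hsub : E₂ '' closedBall 0 1 ⊆ E₁ '' closedBall 0 (1 - 3 * P₁.ε))
    (hε : P₂.ε < P₁.ε) :
    Disjoint (P₁.pushC E₁ '' closedBall 0 1) (P₂.pushC E₂ '' closedBall 0 1) := by
  rw [Set.disjoint_left]
  rintro z ⟨x₁, hx₁, rfl⟩ ⟨x₂, -, h12⟩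
  have hn : P₂.μ ‖x₂‖ = P₁.μ ‖x₁‖ := congrArg Prod.snd h12
  have hdir : E₂ (P₂.dir x₂) = E₁ (P₁.dir x₁) := congrArg Prod.fst h12
  obtain ⟨y, hy, hyE⟩ :=
    hsub ⟨P₂.dir x₂, mem_closedBall_zero_iff.2 (P₂.norm_dir_le_one x₂), hdir⟩
  have hyd : y = P₁.dir x₁ := hE₁ hyE
  have hx₁n : ‖x₁‖ ≤ 1 - 3 * P₁.ε := by
    have h := P₁.norm_le_norm_dir (mem_closedBall_zero_iff.1 hx₁)
    rw [← hyd] at h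
    exact h.trans (mem_closedBall_zero_iff.1 hy)
  have hμ₁ : P₁.μ ‖x₁‖ = 1 - 2 * P₁.ε := P₁.μ_of_le _ (by linarith [P₁.ε_pos])
  have hμ₂ : 1 - 2 * P₂.ε ≤ P₂.μ ‖x₂‖ := P₂.le_μ _
  linarith

/-- **Over the floor region the two heights separate the discs**: a point of the inner pushed
disc has height `≥ 1 - 2ε₂ > 1 - 2ε₁`, the height of the outer disc over `E₁(𝔻_{1-3ε₁})`.
Quantitative form used when stacking several discs. [folklore] -/
theorem snd_pushC_lt_snd_pushC (P₁ P₂ : PushProfile) {E₁ E₂ : V → M} (hε : P₂.ε < P₁.ε)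
    {x₁ : V} (hx₁ : ‖x₁‖ ≤ 1 - 3 * P₁.ε) (x₂ : V) :
    (P₁.pushC E₁ x₁).2 < (P₂.pushC E₂ x₂).2 := by
  have hμ₁ : P₁.μ ‖x₁‖ = 1 - 2 * P₁.ε := P₁.μ_of_le _ (by linarith [P₁.ε_pos])
  have hμ₂ : 1 - 2 * P₂.ε ≤ P₂.μ ‖x₂‖ := P₂.le_μ _
  simp only [pushC_snd]
  linarith

end LaminarCollar

end PushProfile

end Literature.Topology.FourManifolds
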